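import Mathlib
import HarnessLib
import Summits.NavierStokesRegularity.NavierStokesRegularity.Theorems.CompletionRelayChainRelayFrontStepIgnitionClock

/-!
# `CompletionRelayChain` — crux `RelayFrontStep` (24850), LINE `window_v2`, stub `stub_ignition` (Phase II):
  one-sided linear comparison with a VARIABLE coefficient (the `u₂` floor and ceiling on a piece)

Blueprint `IGNITION-BLUEPRINT-crc-p2.md` §1 (S6) / §3 (U₂): old shell 2's trigger obeys
`u₂′ = Λ₂u₂(x₂ − x₃) − (Λ₂/32)x₃r₂ + (Λ₁/32)r₁u₁ ± defect`, i.e. `y′ ≤ k(t)·y + β` for `y = ±u₂` with the SIGNED,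
time-dependent coefficient `k = Λ₂(x₂ − x₃) ∈ [0, K]`. The constant-coefficient lemma `clock_piece_linear` (p615339) needs
`K·y`, which is only an upper bound of `k·y` when `y ≥ 0`; here we prove the variable-coefficient version with the
integrating factor `exp(−∫ₐᵗ k)`:
* `linear_comparison_var` — `y′ ≤ k y + β` on `[a,b] ⊆ [0,τ]`, `k` continuous on `[0,τ]`, `0 ≤ k ≤ K` on `[a,b]`, `β ≥ 0`
  ⇒ `y(t) ≤ max 0 (y(a) + β (t − a)) · exp(K (t − a))` on `[a,b]`.

No definitions. HONEST FRAMING: elementary calculus; helper for the crux, no stub credit; nothing here is a statement about the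
Navier–Stokes equations.
-/

noncomputable section

-- the summit-side namespace repeats a component by design (D-0017)
set_option linter.dupNamespace false

open Set MeasureTheory intervalIntegral

namespace Summit.NavierStokesRegularity.NavierStokesRegularity.Cruxes.RelayFrontStep.Window2

/-- **Variable-coefficient one-sided linear comparison.** Let `y` be `C¹` on `[0,τ]`, `k` continuous on `[0,τ]`,
`[a,b] ⊆ [0,τ]`, and on `[a,b]`: `derivWithin y ≤ k·y + β`, `0 ≤ k ≤ K`, with `β ≥ 0`. Then for `t ∈ [a,b]`,
`y(t) ≤ max 0 (y(a) + β(t − a)) · exp(K(t − a))`. [folklore] -/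
theorem linear_comparison_var {y k : ℝ → ℝ} {τ a b K β : ℝ} (hy : ContDiffOn ℝ 1 y (Icc 0 τ))
    (hk : ContinuousOn k (Icc 0 τ)) (ha : 0 ≤ a) (hab : a ≤ b) (hb : b ≤ τ) (hβ : 0 ≤ β)
    (hk0 : ∀ s ∈ Icc a b, 0 ≤ k s) (hkK : ∀ s ∈ Icc a b, k s ≤ K)
    (hy' : ∀ s ∈ Icc a b, derivWithin y (Icc 0 τ) s ≤ k s * y s + β) :
    ∀ t ∈ Icc a b, y t ≤ max 0 (y a + β * (t - a)) * Real.exp (K * (t - a)) := by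
  have hsubI : Icc a b ⊆ Icc 0 τ := Icc_subset_Icc ha hb
  have hkab : ContinuousOn k (Icc a b) := hk.mono hsubI
  -- the primitive P(t) = ∫_a^t k, its derivative at interior points, continuity, bounds
  set P : ℝ → ℝ := fun t => ∫ s in a..t, k s with hP
  have hPderiv : ∀ t ∈ Ioo a b, HasDerivAt P (k t) t := by
    intro t ht
    have hint : IntervalIntegrable k volume a t :=
      (hkab.mono (by rw [uIcc_of_le ht.1.le]; exact Icc_subset_Icc_right ht.2.le)).intervalIntegrable
    have hmem : Icc a b ∈ nhds t := Icc_mem_nhds ht.1 ht.2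
    have hcont : ContinuousAt k t := hkab.continuousAt hmem
    have hmeas : StronglyMeasurableAtFilter k (nhds t) volume :=
      ContinuousOn.stronglyMeasurableAtFilter isOpen_Ioo (hkab.mono Ioo_subset_Icc_self) t ht
    exact intervalIntegral.integral_hasDerivAt_right hint hmeas hcont
  have hPcont : ContinuousOn P (Icc a b) := by
    have h := intervalIntegral.continuousOn_primitive_interval (μ := volume) (f := k) (a := a) (b := b)
      ((hkab.integrableOn_Icc).mono_set (by rw [uIcc_of_le hab]))
    rwa [uIcc_of_le hab] at h
  have hPnonneg : ∀ t ∈ Icc a b, 0 ≤ P t := fun t ht =>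
    intervalIntegral.integral_nonneg ht.1 fun s hs => hk0 s ⟨hs.1, hs.2.trans ht.2⟩
  have hPle : ∀ t ∈ Icc a b, P t ≤ K * (t - a) := by
    intro t ht
    have hint : IntervalIntegrable k volume a t :=
      (hkab.mono (by rw [uIcc_of_le ht.1]; exact Icc_subset_Icc_right ht.2)).intervalIntegrable
    have h := intervalIntegral.integral_mono_on ht.1 hint (by simp : IntervalIntegrable (fun _ => K) volume a t)
      fun s hs => hkK s ⟨hs.1, hs.2.trans ht.2⟩
    rw [intervalIntegral.integral_const, smul_eq_mul] at h
    simpa [hP, mul_comm] using h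
  -- z(t) := y(t) e^{−P(t)} − β (t − a) is antitone on [a,b]
  set z : ℝ → ℝ := fun t => y t * Real.exp (-P t) - β * (t - a) with hz
  have hL : ∀ t, HasDerivAt (fun t => β * (t - a)) β t := by
    intro t; simpa using ((hasDerivAt_id t).sub_const a).const_mul β
  have hzc : ContinuousOn z (Icc a b) :=
    ((hy.continuousOn.mono hsubI).mul (hPcont.neg.rexp)).sub (fun t _ => (hL t).continuousAt.continuousWithinAt)
  have hzd : DifferentiableOn ℝ z (interior (Icc a b)) := by
    rw [interior_Icc]; intro t ht
    have htI : Icc 0 τ ∈ nhds t := Icc_mem_nhds (lt_of_le_of_lt ha ht.1) (lt_of_lt_of_le ht.2 hb)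
    have hyd : DifferentiableAt ℝ y t := ((hy.differentiableOn one_ne_zero) t (hsubI ⟨ht.1.le, ht.2.le⟩)).differentiableAt htI
    exact ((hyd.mul (hPderiv t ht).neg.exp.differentiableAt).sub (hL t).differentiableAt).differentiableWithinAt
  have hz' : ∀ t ∈ interior (Icc a b), deriv z t ≤ 0 := by
    rw [interior_Icc]; intro t ht
    have htI : Icc 0 τ ∈ nhds t := Icc_mem_nhds (lt_of_le_of_lt ha ht.1) (lt_of_lt_of_le ht.2 hb)
    have hmem : t ∈ Icc 0 τ := hsubI ⟨ht.1.le, ht.2.le⟩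
    have hyd : DifferentiableWithinAt ℝ y (Icc 0 τ) t := (hy.differentiableOn one_ne_zero) t hmem
    have hyda : HasDerivAt y (derivWithin y (Icc 0 τ) t) t := by
      rw [derivWithin_of_mem_nhds htI]; exact (hyd.differentiableAt htI).hasDerivAt
    have hE : HasDerivAt (fun t => Real.exp (-P t)) (Real.exp (-P t) * (-k t)) t := (hPderiv t ht).neg.exp
    have hder : HasDerivAt z (derivWithin y (Icc 0 τ) t * Real.exp (-P t) + y t * (Real.exp (-P t) * (-k t)) - β) t :=
      (hyda.mul hE).sub (hL t)
    rw [hder.deriv]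
    have hpos : 0 < Real.exp (-P t) := Real.exp_pos _
    have hle1 : Real.exp (-P t) ≤ 1 := by
      rw [Real.exp_le_one_iff]; linarith [hPnonneg t ⟨ht.1.le, ht.2.le⟩]
    have h1 := hy' t ⟨ht.1.le, ht.2.le⟩
    have h2 : (derivWithin y (Icc 0 τ) t - k t * y t) * Real.exp (-P t) ≤ β * Real.exp (-P t) :=
      mul_le_mul_of_nonneg_right (by linarith) hpos.le
    have h3 : β * Real.exp (-P t) ≤ β := by nlinarith
    nlinarith
  have hanti : AntitoneOn z (Icc a b) := antitoneOn_of_deriv_nonpos (convex_Icc a b) hzc hzd hz'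
  intro t ht
  have h1 := hanti (left_mem_Icc.mpr hab) ht ht.1
  have hPa : P a = 0 := by simp [hP]
  simp only [hz, hPa, neg_zero, Real.exp_zero, mul_one, sub_self, mul_zero, sub_zero] at h1
  -- y t e^{−P t} ≤ y a + β(t−a) ⇒ y t ≤ (y a + β(t−a)) e^{P t} ≤ max 0 (…) e^{K(t−a)}
  have hposP : 0 < Real.exp (P t) := Real.exp_pos _
  have e : Real.exp (-P t) * Real.exp (P t) = 1 := by rw [← Real.exp_add]; simp
  have h2 : y t * Real.exp (-P t) ≤ y a + β * (t - a) := by linarith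
  have h3 : y t ≤ (y a + β * (t - a)) * Real.exp (P t) := by
    calc y t = (y t * Real.exp (-P t)) * Real.exp (P t) := by rw [mul_assoc, e, mul_one]
      _ ≤ (y a + β * (t - a)) * Real.exp (P t) := mul_le_mul_of_nonneg_right h2 hposP.le
  have h4 : Real.exp (P t) ≤ Real.exp (K * (t - a)) := Real.exp_le_exp.mpr (hPle t ht)
  have h5 : (y a + β * (t - a)) * Real.exp (P t) ≤ max 0 (y a + β * (t - a)) * Real.exp (P t) :=
    mul_le_mul_of_nonneg_right (le_max_right _ _) hposP.le
  have h6 : max 0 (y a + β * (t - a)) * Real.exp (P t) ≤ max 0 (y a + β * (t - a)) * Real.exp (K * (t - a)) :=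
    mul_le_mul_of_nonneg_left h4 (le_max_left _ _)
  linarith

end Summit.NavierStokesRegularity.NavierStokesRegularity.Cruxes.RelayFrontStep.Window2
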